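import Literature.NumberTheory.Automorphic.SLTwoTreeProjectiveActionIso       -- ★ B-p08 (g28) (W1c)-A parts 1–3: `glVertexAct`, `_scalar_mul`, `latticeTree_adj_glVertexAct_iff`
import Literature.NumberTheory.Automorphic.SLTwoTreeTransitive                 -- ★ B-p08 (g28) (W1c)-A part 4: transitivity with prescribed determinant
import Literature.NumberTheory.Automorphic.UnitaryGroupAutomorphicRep          -- ★ `unitaryGroupOfForm`, `mem_unitaryGroupOfForm_iff`
import HarnessLib

/-!
# The action of `U(Φ₂)(E)` on the tree of `SL₂(F)` through `ρ : U(Φ₂) → PGL₂(F)` — definition over the DESCENT PROPERTY as a hypothesis, multiplicativity,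
# adjacency, and ONE VERTEX ORBIT ∕ ONE DART ORBIT when a uniformizer of `F` is a norm (Serre, *Trees* II.1.2–1.4; Tits 1979 §2.7; Bruhat–Tits 1984 §4.2)

Topic `NumberTheory/Automorphic`; namespace `Literature.NumberTheory.Automorphic.UnitaryGroup`.  Two DEFINITIONS (`rhoGL`, `rhoVertexAct`) and theorems; no instance, no
notation, no named fact, no `sorry`.  Cell `pub/hodgecm-mathlib` (D-0151), crux H413 = `stmt-HodgeConjecture-24833`, line «N6nsGerm», residue «R2EP-wild» of
`stub_N6nsR2EP : RankOneEulerPoincareNonsplit`, ROAD W brick (W1c)-B (census `B-provers/B-p08/g28/CENSUS-W1c-W2-TreeAction.B-p08g28.md`; road memo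
`F0/P3a/F0P3a-p04/g13/MEMO-R2wild.F0P3a-p04g13.md` (S2)–(S3)).  GENERIC: `F` discretely valued with uniformizer `ϖ` (the tree `X = latticeTree (RingHom.id F) ϖ J`,
`J = (0 1; −1 0)`, ★ (W0)), `ι : F →+* E` and `σ : E →+* E` ring maps, `α ∈ E` with `σα = −α ≠ 0`, `U := unitaryGroupOfForm σ Φ₂`, `Φ₂ = (0 1; 1 0)`; the DESCENT PROPERTY
`hρ : ∀ u ∈ U, ∃ s ≠ 0, ∃ g ∈ GL₂(F), diag(1,α) u diag(1,α)⁻¹ = s · ι(g)` is a HYPOTHESIS here — at a non-split place of a quadratic extension of number fields it is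
★ F0P3a-p04 (g13) `exists_conj_diagonal_eq_smul_map_toPlace` (W1 §3).  HONEST LABEL: HC_CM is proved only modulo the cell's 2 remaining named inputs (hLiu418, h413) until
rung 0 closes; nothing printed is asserted here.

THE MATHEMATICS.  §1 `g` is determined by `u` up to `F^×` (`s ι(g) = s′ ι(g′) ⇒ g′ = c·g`, `c ∈ F^×`: `exists_units_eq_scalar_mul_of_smul_map_eq`), so
`ρ(u) · M := g · M` (★ `glVertexAct`, which kills the centre) is well defined: `rhoGL`, `rhoVertexAct`, **`rhoVertexAct_eq_glVertexAct`** (ANY representative computes it);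
representatives multiply (`diag(1,α)⁻¹ diag(1,α) = 1`), whence **`rhoVertexAct_one`**, **`rhoVertexAct_mul`**, and **`latticeTree_adj_rhoVertexAct_iff`** (★ part 3).
§2 Conversely `diag(1,α)⁻¹ (s ι(g)) diag(1,α) ∈ U` as soon as `σ(s) s ι(det g) = 1` (`σ ∘ ι = ι`; the hermitian form becomes `α⁻¹ J` in the conjugated frame and
`ᵗg J g = det g · J`): **`exists_mem_unitaryGroupOfForm_conj_eq_smul_map`** — so `SL₂(F) ⊆ ρ(U)` (`s = 1`) and `[g] ∈ ρ(U)` whenever `det g` is a norm.  §3 With ★ part 4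
(`SL₂(F)`∕`GL₂(F)` transitivity with PRESCRIBED determinant): `U` moves the root `v₀ = 𝒪²` to every self-dual vertex; if some `c` with `|c| = |ϖ|` is a norm
(`σ(t) t ι(c) = 1` — at a RAMIFIED place `c = N(ϖ_E)`), also to every `ϖ`-modular vertex — **`exists_rhoVertexAct_eq`** (ONE VERTEX ORBIT, the `hV` of B-p14 (g32)'s
`…_of_vertexAction_local`) — and the reference dart `(v₀, v₁)`, `v₁ = 𝒪 ⊕ ϖ𝒪`, to every dart — **`exists_rhoVertexAct_eq_of_adj`** (ONE DART ORBIT, inversions included, `hD`).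

## References
* [Serre1980Trees] J.-P. Serre, *Trees* (1980), Ch. II §1.2–§1.4.
* [Tits1979] J. Tits, *Reductive groups over local fields*, PSPM 33.1 (1979), §2.7, §3.9 (ramified quasi-split `SU₃`∕`U₂`: the building is the tree of `SL₂`).
* [Kottwitz1988] R. E. Kottwitz, *Tamagawa numbers*, Ann. of Math. 127 (1988), §2.
-/

set_option autoImplicit false

noncomputable section

open scoped ValuativeRel Matrix MatrixGroups
open Matrix ValuativeRel

namespace Literature.NumberTheory.Automorphic.UnitaryGroup

open Literature.NumberTheory.Automorphic Literature.NumberTheory.Automorphic.HermitianLatticeTree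

variable {F : Type*} [Field F] {E : Type*} [Field E] (ι : F →+* E) (σ : E →+* E) {α : E}

/-! ## §1 The representative `g` is unique up to `F^×`; unitary lifts -/

section Descent

/-- **UNIQUENESS OF THE DESCENT UP TO THE CENTRE**: `s · ι(g) = s′ · ι(g′)` with `s, s′ ≠ 0` forces `g′ = (c · 1) g` for some `c ∈ F^×` (`ι(g′g⁻¹) = (s∕s′) · 1` is scalar,
and `ι` is injective). [cite: Serre1980Trees, Ch. II §1.2–§1.3] -/
theorem exists_units_eq_scalar_mul_of_smul_map_eq {s s' : E} (hs : s ≠ 0) (hs' : s' ≠ 0) {g g' : GL (Fin 2) F}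
    (h : s • (g : Matrix (Fin 2) (Fin 2) F).map ι = s' • (g' : Matrix (Fin 2) (Fin 2) F).map ι) :
    ∃ c : Fˣ, g' = c.map ((Matrix.scalar (Fin 2) : F →+* Matrix (Fin 2) (Fin 2) F) : F →* Matrix (Fin 2) (Fin 2) F) * g := by
  -- `x := g′ g⁻¹` has `ι(x) = (s∕s′) · 1`
  set x : GL (Fin 2) F := g' * g⁻¹ with hx
  have hmapx : (x : Matrix (Fin 2) (Fin 2) F).map ι = (s'⁻¹ * s) • (1 : Matrix (Fin 2) (Fin 2) E) := by
    have h1 : (g' : Matrix (Fin 2) (Fin 2) F).map ι = (s'⁻¹ * s) • (g : Matrix (Fin 2) (Fin 2) F).map ι := by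
      rw [mul_smul, h, smul_smul, inv_mul_cancel₀ hs', one_smul]
    rw [hx, Units.val_mul, Matrix.map_mul, h1, Matrix.smul_mul, ← Matrix.map_mul, ← Units.val_mul, mul_inv_cancel, Units.val_one,
      Matrix.map_one ι (map_zero ι) (map_one ι)]
  -- read off the entries
  have h00 : ι ((x : Matrix (Fin 2) (Fin 2) F) 0 0) = s'⁻¹ * s := by
    have := congrFun (congrFun hmapx 0) 0; simpa using this
  have h11 : ι ((x : Matrix (Fin 2) (Fin 2) F) 1 1) = s'⁻¹ * s := by
    have := congrFun (congrFun hmapx 1) 1; simpa using this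
  have h01 : (x : Matrix (Fin 2) (Fin 2) F) 0 1 = 0 := by
    have := congrFun (congrFun hmapx 0) 1; simpa using this
  have h10 : (x : Matrix (Fin 2) (Fin 2) F) 1 0 = 0 := by
    have := congrFun (congrFun hmapx 1) 0; simpa using this
  have hc0 : (x : Matrix (Fin 2) (Fin 2) F) 0 0 ≠ 0 := by
    intro h0
    rw [h0, map_zero] at h00
    exact mul_ne_zero (inv_ne_zero hs') hs h00.symm
  have hdiag : (x : Matrix (Fin 2) (Fin 2) F) 1 1 = (x : Matrix (Fin 2) (Fin 2) F) 0 0 := ι.injective (by rw [h11, h00])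
  refine ⟨Units.mk0 _ hc0, ?_⟩
  have hxval : (x : Matrix (Fin 2) (Fin 2) F) =
      (((Units.mk0 _ hc0).map ((Matrix.scalar (Fin 2) : F →+* Matrix (Fin 2) (Fin 2) F) : F →* Matrix (Fin 2) (Fin 2) F) : GL (Fin 2) F) :
        Matrix (Fin 2) (Fin 2) F) := by
    rw [Units.coe_map, Units.val_mk0, MonoidHom.coe_coe, Matrix.scalar_apply]
    ext i j
    fin_cases i <;> fin_cases j <;> simp [h01, h10, hdiag]
  have hxeq : x = (Units.mk0 _ hc0).map ((Matrix.scalar (Fin 2) : F →+* Matrix (Fin 2) (Fin 2) F) : F →* Matrix (Fin 2) (Fin 2) F) := Units.ext hxval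
  rw [← hxeq, hx, inv_mul_cancel_right]

/-- The descent property of `U(Φ₂)` (a HYPOTHESIS in this file; ★ `exists_conj_diagonal_eq_smul_map_toPlace` at a non-split place): every `u ∈ U` has
`diag(1,α) u diag(1,α)⁻¹ = s · ι(g)` with `s ≠ 0`, `g ∈ GL₂(F)`.  `rhoGL u` CHOOSES such a `g`. [cite: Serre1980Trees, Ch. II §1.2–§1.3] [cite: Tits1979, §2.7 and §3.9] -/
def rhoGL (hρ : ∀ u : GL (Fin 2) E, u ∈ unitaryGroupOfForm σ !![(0 : E), 1; 1, 0] →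
      ∃ (s : E) (g : GL (Fin 2) F), s ≠ 0 ∧ Matrix.diagonal ![1, α] * (u : Matrix (Fin 2) (Fin 2) E) * Matrix.diagonal ![1, α⁻¹] =
        s • (g : Matrix (Fin 2) (Fin 2) F).map ι)
    (u : ↥(unitaryGroupOfForm σ !![(0 : E), 1; 1, 0])) : GL (Fin 2) F :=
  Classical.choose (Classical.choose_spec (hρ u u.2))

/-- The defining property of `rhoGL u`. [cite: Serre1980Trees, Ch. II §1.2–§1.3] -/
theorem rhoGL_spec (hρ : ∀ u : GL (Fin 2) E, u ∈ unitaryGroupOfForm σ !![(0 : E), 1; 1, 0] →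
      ∃ (s : E) (g : GL (Fin 2) F), s ≠ 0 ∧ Matrix.diagonal ![1, α] * (u : Matrix (Fin 2) (Fin 2) E) * Matrix.diagonal ![1, α⁻¹] =
        s • (g : Matrix (Fin 2) (Fin 2) F).map ι)
    (u : ↥(unitaryGroupOfForm σ !![(0 : E), 1; 1, 0])) :
    ∃ s : E, s ≠ 0 ∧ Matrix.diagonal ![1, α] * ((u : GL (Fin 2) E) : Matrix (Fin 2) (Fin 2) E) * Matrix.diagonal ![1, α⁻¹] =
      s • ((rhoGL ι σ hρ u : GL (Fin 2) F) : Matrix (Fin 2) (Fin 2) F).map ι :=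
  ⟨Classical.choose (hρ u u.2), Classical.choose_spec (Classical.choose_spec (hρ u u.2))⟩

/-- `diag(1, α⁻¹) · diag(1, α) = 1`. [cite: Serre1980Trees, Ch. II §1.2] -/
theorem diagonal_inv_mul_diagonal (hα0 : α ≠ 0) : Matrix.diagonal ![(1 : E), α⁻¹] * Matrix.diagonal ![1, α] = 1 := by
  rw [diagonal_mul_diagonal, ← diagonal_one]
  congr 1
  funext i
  fin_cases i <;> simp [inv_mul_cancel₀ hα0]

/-- `diag(1, α) · diag(1, α⁻¹) = 1`. [cite: Serre1980Trees, Ch. II §1.2] -/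
theorem diagonal_mul_diagonal_inv (hα0 : α ≠ 0) : Matrix.diagonal ![(1 : E), α] * Matrix.diagonal ![1, α⁻¹] = 1 := by
  rw [diagonal_mul_diagonal, ← diagonal_one]
  congr 1
  funext i
  fin_cases i <;> simp [mul_inv_cancel₀ hα0]

/-! ## §2 The image of `ρ`: `diag(1,α)⁻¹ (s ι(g)) diag(1,α) ∈ U(Φ₂)` iff `σ(s) s ι(det g) = 1` -/

/-- **UNITARY LIFTS**: if `σ ∘ ι = ι`, `σα = −α ≠ 0` and `σ(s) · s · ι(det g) = 1`, then there is `u ∈ U(Φ₂)` with `diag(1,α) u diag(1,α)⁻¹ = s · ι(g)` — namely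
`u = diag(1,α)⁻¹ (s ι(g)) diag(1,α)`: in the conjugated frame the form is `α⁻¹ J`, `J` alternating, and `ᵗg J g = det g · J`.  In particular `SL₂(F) ⊆ ρ(U)` (`s = 1`), and
`[g] ∈ ρ(U)` whenever `det g ∈ N(E^×)`. [cite: Serre1980Trees, Ch. II §1.2–§1.3] [cite: Tits1979, §2.7 and §3.9] -/
theorem exists_mem_unitaryGroupOfForm_conj_eq_smul_map (hσι : ∀ x : F, σ (ι x) = ι x) (hα : σ α = -α) (hα0 : α ≠ 0)
    {s : E} {g : GL (Fin 2) F} (h : σ s * s * ι (g : Matrix (Fin 2) (Fin 2) F).det = 1) :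
    ∃ u : ↥(unitaryGroupOfForm σ !![(0 : E), 1; 1, 0]),
      Matrix.diagonal ![1, α] * ((u : GL (Fin 2) E) : Matrix (Fin 2) (Fin 2) E) * Matrix.diagonal ![1, α⁻¹] = s • (g : Matrix (Fin 2) (Fin 2) F).map ι := by
  have hs : s ≠ 0 := by rintro rfl; rw [mul_zero, zero_mul] at h; exact zero_ne_one h
  have hdetg : (g : Matrix (Fin 2) (Fin 2) F).det ≠ 0 := (g.isUnit.map Matrix.detMonoidHom).ne_zero
  have hαα : α⁻¹ * α = 1 := inv_mul_cancel₀ hα0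
  have hαα' : α * α⁻¹ = 1 := mul_inv_cancel₀ hα0
  -- the candidate matrix `x = diag(1,α)⁻¹ (s ι(g)) diag(1,α)`, written out
  set x : Matrix (Fin 2) (Fin 2) E := !![s * ι ((g : Matrix (Fin 2) (Fin 2) F) 0 0), α * (s * ι ((g : Matrix (Fin 2) (Fin 2) F) 0 1));
    α⁻¹ * (s * ι ((g : Matrix (Fin 2) (Fin 2) F) 1 0)), s * ι ((g : Matrix (Fin 2) (Fin 2) F) 1 1)] with hxdef
  have hdetx : x.det = s ^ 2 * ι (g : Matrix (Fin 2) (Fin 2) F).det := by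
    rw [hxdef, det_fin_two_of, det_fin_two, map_sub, map_mul, map_mul]
    linear_combination (-(s * ι ((g : Matrix (Fin 2) (Fin 2) F) 0 1)) * (s * ι ((g : Matrix (Fin 2) (Fin 2) F) 1 0))) * hαα'
  have hdetx0 : x.det ≠ 0 := by
    rw [hdetx]; exact mul_ne_zero (pow_ne_zero _ hs) (by rw [map_ne_zero]; exact hdetg)
  set u : GL (Fin 2) E := Matrix.GeneralLinearGroup.mk'' x (isUnit_iff_ne_zero.2 hdetx0) with hudef
  have huval : (u : Matrix (Fin 2) (Fin 2) E) = x := rfl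
  -- unitarity: a 2×2 identity from `σ(s) s ι(det g) = 1`
  have hdet' : σ s * s * (ι ((g : Matrix (Fin 2) (Fin 2) F) 0 0) * ι ((g : Matrix (Fin 2) (Fin 2) F) 1 1) -
      ι ((g : Matrix (Fin 2) (Fin 2) F) 0 1) * ι ((g : Matrix (Fin 2) (Fin 2) F) 1 0)) = 1 := by
    rw [det_fin_two, map_sub, map_mul, map_mul] at h; exact h
  have hu : u ∈ unitaryGroupOfForm σ !![(0 : E), 1; 1, 0] := by
    rw [mem_unitaryGroupOfForm_iff, huval, hxdef]
    ext i j
    fin_cases i <;> fin_cases j <;> simp [Matrix.mul_apply, Fin.sum_univ_two, hσι, hα]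
    all_goals first
      | ring1
      | linear_combination hdet' - (σ s * s * ι ((g : Matrix (Fin 2) (Fin 2) F) 0 1) * ι ((g : Matrix (Fin 2) (Fin 2) F) 1 0)) * hαα
  refine ⟨⟨u, hu⟩, ?_⟩
  show Matrix.diagonal ![1, α] * x * Matrix.diagonal ![1, α⁻¹] = _
  rw [hxdef]
  ext i j
  fin_cases i <;> fin_cases j <;> simp [Matrix.mul_apply, Matrix.diagonal]
  all_goals first
    | ring1
    | linear_combination (s * ι ((g : Matrix (Fin 2) (Fin 2) F) 0 1)) * hαα'
    | linear_combination (s * ι ((g : Matrix (Fin 2) (Fin 2) F) 1 0)) * hαα'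
    | linear_combination (s * ι ((g : Matrix (Fin 2) (Fin 2) F) 1 1)) * hαα'

end Descent

/-! ## §3 The vertex action `ρ(u) · M := g · M` on the tree of `SL₂(F)` -/

section Tree

variable [ValuativeRel F] {ϖ : F} (hϖ : IsUniformizingElement ϖ) [IsDiscreteValuationRing 𝒪[F]]

/-- **THE VERTEX ACTION OF `U(Φ₂)(E)` ON THE TREE OF `SL₂(F)`**: `ρ(u) · M := g · M` for any descent representative `g` (★ `glVertexAct`; independent of the choice by
`rhoVertexAct_eq_glVertexAct`). [cite: Serre1980Trees, Ch. II §1.2–§1.3] [cite: Tits1979, §2.7 and §3.9] -/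
def rhoVertexAct (hρ : ∀ u : GL (Fin 2) E, u ∈ unitaryGroupOfForm σ !![(0 : E), 1; 1, 0] →
      ∃ (s : E) (g : GL (Fin 2) F), s ≠ 0 ∧ Matrix.diagonal ![1, α] * (u : Matrix (Fin 2) (Fin 2) E) * Matrix.diagonal ![1, α⁻¹] =
        s • (g : Matrix (Fin 2) (Fin 2) F).map ι)
    (u : ↥(unitaryGroupOfForm σ !![(0 : E), 1; 1, 0]))
    (M : {M : Submodule 𝒪[F] (Fin 2 → F) // IsSpecialLattice (RingHom.id F) ϖ !![(0 : F), 1; -1, 0] M}) :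
    {M : Submodule 𝒪[F] (Fin 2 → F) // IsSpecialLattice (RingHom.id F) ϖ !![(0 : F), 1; -1, 0] M} :=
  glVertexAct hϖ (rhoGL ι σ hρ u) M

section Action

variable (hρ : ∀ u : GL (Fin 2) E, u ∈ unitaryGroupOfForm σ !![(0 : E), 1; 1, 0] →
      ∃ (s : E) (g : GL (Fin 2) F), s ≠ 0 ∧ Matrix.diagonal ![1, α] * (u : Matrix (Fin 2) (Fin 2) E) * Matrix.diagonal ![1, α⁻¹] =
        s • (g : Matrix (Fin 2) (Fin 2) F).map ι)

include hϖ in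
/-- **INDEPENDENCE OF THE REPRESENTATIVE**: if `diag(1,α) u diag(1,α)⁻¹ = s · ι(g)` with `s ≠ 0`, then `ρ(u) · M = g · M`. [cite: Serre1980Trees, Ch. II §1.2–§1.3] -/
theorem rhoVertexAct_eq_glVertexAct (u : ↥(unitaryGroupOfForm σ !![(0 : E), 1; 1, 0])) {s : E} {g : GL (Fin 2) F} (hs : s ≠ 0)
    (h : Matrix.diagonal ![1, α] * ((u : GL (Fin 2) E) : Matrix (Fin 2) (Fin 2) E) * Matrix.diagonal ![1, α⁻¹] = s • (g : Matrix (Fin 2) (Fin 2) F).map ι)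
    (M : {M : Submodule 𝒪[F] (Fin 2 → F) // IsSpecialLattice (RingHom.id F) ϖ !![(0 : F), 1; -1, 0] M}) :
    rhoVertexAct ι σ hϖ hρ u M = glVertexAct hϖ g M := by
  obtain ⟨s₀, hs₀, h₀⟩ := rhoGL_spec ι σ hρ u
  obtain ⟨c, hc⟩ := exists_units_eq_scalar_mul_of_smul_map_eq ι hs₀ hs (h₀.symm.trans h)
  rw [rhoVertexAct, ← glVertexAct_scalar_mul hϖ c, ← hc]

include hϖ in
/-- **`ρ(1) = id`**. [cite: Serre1980Trees, Ch. II §1.2–§1.3] -/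
theorem rhoVertexAct_one (hα0 : α ≠ 0) (M : {M : Submodule 𝒪[F] (Fin 2 → F) // IsSpecialLattice (RingHom.id F) ϖ !![(0 : F), 1; -1, 0] M}) :
    rhoVertexAct ι σ hϖ hρ 1 M = M := by
  have h : Matrix.diagonal ![1, α] * (((1 : ↥(unitaryGroupOfForm σ !![(0 : E), 1; 1, 0])) : GL (Fin 2) E) : Matrix (Fin 2) (Fin 2) E) *
      Matrix.diagonal ![1, α⁻¹] = (1 : E) • ((1 : GL (Fin 2) F) : Matrix (Fin 2) (Fin 2) F).map ι := by
    rw [OneMemClass.coe_one, Units.val_one, Matrix.mul_one, diagonal_mul_diagonal_inv hα0, one_smul, Units.val_one, Matrix.map_one ι (map_zero ι) (map_one ι)]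
  rw [rhoVertexAct_eq_glVertexAct ι σ hϖ hρ 1 one_ne_zero h, glVertexAct_one]

include hϖ in
/-- **`ρ(u u′) = ρ(u) ∘ ρ(u′)`** (representatives multiply: `(s ι g)(s′ ι g′) = (s s′) ι(g g′)`). [cite: Serre1980Trees, Ch. II §1.2–§1.3] -/
theorem rhoVertexAct_mul (hα0 : α ≠ 0) (u u' : ↥(unitaryGroupOfForm σ !![(0 : E), 1; 1, 0]))
    (M : {M : Submodule 𝒪[F] (Fin 2 → F) // IsSpecialLattice (RingHom.id F) ϖ !![(0 : F), 1; -1, 0] M}) :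
    rhoVertexAct ι σ hϖ hρ (u * u') M = rhoVertexAct ι σ hϖ hρ u (rhoVertexAct ι σ hϖ hρ u' M) := by
  obtain ⟨s, hs, h⟩ := rhoGL_spec ι σ hρ u
  obtain ⟨s', hs', h'⟩ := rhoGL_spec ι σ hρ u'
  have hmul : Matrix.diagonal ![1, α] * (((u * u' : ↥(unitaryGroupOfForm σ !![(0 : E), 1; 1, 0])) : GL (Fin 2) E) : Matrix (Fin 2) (Fin 2) E) *
      Matrix.diagonal ![1, α⁻¹] = (s * s') • (((rhoGL ι σ hρ u * rhoGL ι σ hρ u' : GL (Fin 2) F)) : Matrix (Fin 2) (Fin 2) F).map ι := by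
    have hsplit : Matrix.diagonal ![1, α] * (((u * u' : ↥(unitaryGroupOfForm σ !![(0 : E), 1; 1, 0])) : GL (Fin 2) E) : Matrix (Fin 2) (Fin 2) E) *
        Matrix.diagonal ![1, α⁻¹] =
        (Matrix.diagonal ![1, α] * ((u : GL (Fin 2) E) : Matrix (Fin 2) (Fin 2) E) * Matrix.diagonal ![1, α⁻¹]) *
          (Matrix.diagonal ![1, α] * ((u' : GL (Fin 2) E) : Matrix (Fin 2) (Fin 2) E) * Matrix.diagonal ![1, α⁻¹]) := by
      rw [Subgroup.coe_mul, Units.val_mul]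
      simp only [Matrix.mul_assoc]
      rw [← Matrix.mul_assoc (Matrix.diagonal ![1, α⁻¹]) (Matrix.diagonal ![1, α]), diagonal_inv_mul_diagonal hα0, Matrix.one_mul]
    rw [hsplit, h, h', Matrix.smul_mul, Matrix.mul_smul, smul_smul, Units.val_mul, Matrix.map_mul]
  rw [rhoVertexAct_eq_glVertexAct ι σ hϖ hρ (u * u') (mul_ne_zero hs hs') hmul, glVertexAct_mul]
  rfl

include hϖ in
/-- **`ρ(u)` PRESERVES AND REFLECTS ADJACENCY** (★ `latticeTree_adj_glVertexAct_iff`). [cite: Serre1980Trees, Ch. II §1.2–§1.3] -/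
theorem latticeTree_adj_rhoVertexAct_iff (u : ↥(unitaryGroupOfForm σ !![(0 : E), 1; 1, 0]))
    (a b : {M : Submodule 𝒪[F] (Fin 2 → F) // IsSpecialLattice (RingHom.id F) ϖ !![(0 : F), 1; -1, 0] M}) :
    (latticeTree (RingHom.id F) ϖ !![(0 : F), 1; -1, 0]).Adj (rhoVertexAct ι σ hϖ hρ u a) (rhoVertexAct ι σ hϖ hρ u b) ↔
      (latticeTree (RingHom.id F) ϖ !![(0 : F), 1; -1, 0]).Adj a b :=
  latticeTree_adj_glVertexAct_iff hϖ _ a b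

/-! ## §4 One vertex orbit and one dart orbit of `U(Φ₂)` (the binders `hV`, `hD` of the tree-action Euler relation) -/

/-- **`U(Φ₂)` MOVES THE ROOT TO EVERY SELF-DUAL VERTEX** (through `SL₂(F) ⊆ ρ(U)`: ★ `exists_det_eq_one_and_glVertexAct_eq` + unitary lift with `s = 1`).
[cite: Serre1980Trees, Ch. II §1.2–§1.4] [cite: Tits1979, §2.7 and §3.9] -/
theorem exists_rhoVertexAct_eq_of_isSelfDualLattice (hσι : ∀ x : F, σ (ι x) = ι x) (hα : σ α = -α) (hα0 : α ≠ 0)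
    (v₀ : {M : Submodule 𝒪[F] (Fin 2 → F) // IsSpecialLattice (RingHom.id F) ϖ !![(0 : F), 1; -1, 0] M}) (hv₀ : v₀.1 = latt (1 : Matrix (Fin 2) (Fin 2) F))
    (N : {M : Submodule 𝒪[F] (Fin 2 → F) // IsSpecialLattice (RingHom.id F) ϖ !![(0 : F), 1; -1, 0] M}) (hN : IsSelfDualLattice (RingHom.id F) !![(0 : F), 1; -1, 0] N.1) :
    ∃ u : ↥(unitaryGroupOfForm σ !![(0 : E), 1; 1, 0]), rhoVertexAct ι σ hϖ hρ u v₀ = N := by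
  obtain ⟨g, hg1, hgN⟩ := exists_det_eq_one_and_glVertexAct_eq hϖ v₀ hv₀ N hN
  obtain ⟨u, hu⟩ := exists_mem_unitaryGroupOfForm_conj_eq_smul_map ι σ hσι hα hα0 (s := 1) (g := g)
    (by rw [hg1, map_one, map_one, one_mul, one_mul])
  exact ⟨u, by rw [rhoVertexAct_eq_glVertexAct ι σ hϖ hρ u one_ne_zero hu, hgN]⟩

/-- **… AND TO EVERY `ϖ`-MODULAR VERTEX AS SOON AS SOME `c` WITH `|c| = |ϖ|` IS A NORM** (`σ(t) t ι(c) = 1`; at a ramified place `c = N(ϖ_E)`, `t = ϖ_E⁻¹`):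
★ `exists_det_eq_and_glVertexAct_eq` with `det g = c` + unitary lift with `s = t`. [cite: Serre1980Trees, Ch. II §1.2–§1.4] [cite: Tits1979, §2.7 and §3.9] -/
theorem exists_rhoVertexAct_eq_of_isModularLattice (hσι : ∀ x : F, σ (ι x) = ι x) (hα : σ α = -α) (hα0 : α ≠ 0)
    {c : F} {t : E} (hc : valuation F c = valuation F ϖ) (ht : σ t * t * ι c = 1)
    (v₀ : {M : Submodule 𝒪[F] (Fin 2 → F) // IsSpecialLattice (RingHom.id F) ϖ !![(0 : F), 1; -1, 0] M}) (hv₀ : v₀.1 = latt (1 : Matrix (Fin 2) (Fin 2) F))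
    (N : {M : Submodule 𝒪[F] (Fin 2 → F) // IsSpecialLattice (RingHom.id F) ϖ !![(0 : F), 1; -1, 0] M}) (hN : IsModularLattice (RingHom.id F) ϖ !![(0 : F), 1; -1, 0] N.1) :
    ∃ u : ↥(unitaryGroupOfForm σ !![(0 : E), 1; 1, 0]), rhoVertexAct ι σ hϖ hρ u v₀ = N := by
  obtain ⟨g, hgc, hgN⟩ := exists_det_eq_and_glVertexAct_eq hϖ v₀ hv₀ N hN hc
  have ht0 : t ≠ 0 := by rintro rfl; rw [mul_zero, zero_mul] at ht; exact zero_ne_one ht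
  obtain ⟨u, hu⟩ := exists_mem_unitaryGroupOfForm_conj_eq_smul_map ι σ hσι hα hα0 (s := t) (g := g) (by rw [hgc]; exact ht)
  exact ⟨u, by rw [rhoVertexAct_eq_glVertexAct ι σ hϖ hρ u ht0 hu, hgN]⟩

/-- **ONE VERTEX ORBIT (`hV`)**: if some element of valuation `|ϖ|` of `F` is a norm from `E` (RAMIFIED quadratic `E ∕ F`), `U(Φ₂)(E)` is transitive on the vertices of the tree
of `SL₂(F)` — the two `SL₂(F)`-orbits (types) are swapped by `ρ(t_ϖ)`. [cite: Serre1980Trees, Ch. II §1.2–§1.4] [cite: Tits1979, §2.7 and §3.9] [cite: Kottwitz1988, §2] -/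
theorem exists_rhoVertexAct_eq (hσι : ∀ x : F, σ (ι x) = ι x) (hα : σ α = -α) (hα0 : α ≠ 0)
    (hnorm : ∃ (c : F) (t : E), valuation F c = valuation F ϖ ∧ σ t * t * ι c = 1)
    (v₀ : {M : Submodule 𝒪[F] (Fin 2 → F) // IsSpecialLattice (RingHom.id F) ϖ !![(0 : F), 1; -1, 0] M}) (hv₀ : v₀.1 = latt (1 : Matrix (Fin 2) (Fin 2) F)) (N : {M : Submodule 𝒪[F] (Fin 2 → F) // IsSpecialLattice (RingHom.id F) ϖ !![(0 : F), 1; -1, 0] M}) :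
    ∃ u : ↥(unitaryGroupOfForm σ !![(0 : E), 1; 1, 0]), rhoVertexAct ι σ hϖ hρ u v₀ = N := by
  rcases N.2 with hN | hN
  · exact exists_rhoVertexAct_eq_of_isSelfDualLattice ι σ hϖ hρ hσι hα hα0 v₀ hv₀ N hN
  · obtain ⟨c, t, hc, ht⟩ := hnorm
    exact exists_rhoVertexAct_eq_of_isModularLattice ι σ hϖ hρ hσι hα hα0 hc ht v₀ hv₀ N hN

/-- **ONE DART ORBIT (`hD`)**: under the same norm hypothesis `U(Φ₂)(E)` moves the reference dart `(v₀, v₁)`, `v₁ = latt diag(1, ϖ)`, to every dart `(a, b)` of the tree —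
edges AND inversions (★ `exists_det_eq_one_and_glVertexAct_eq_of_adj` ∕ `exists_det_eq_and_glVertexAct_eq_of_adj` + unitary lifts).
[cite: Serre1980Trees, Ch. II §1.2–§1.4] [cite: Tits1979, §2.7 and §3.9] [cite: Kottwitz1988, §2] -/
theorem exists_rhoVertexAct_eq_of_adj (hσι : ∀ x : F, σ (ι x) = ι x) (hα : σ α = -α) (hα0 : α ≠ 0)
    (hnorm : ∃ (c : F) (t : E), valuation F c = valuation F ϖ ∧ σ t * t * ι c = 1)
    (v₀ v₁ : {M : Submodule 𝒪[F] (Fin 2 → F) // IsSpecialLattice (RingHom.id F) ϖ !![(0 : F), 1; -1, 0] M})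
    (hv₀ : v₀.1 = latt (1 : Matrix (Fin 2) (Fin 2) F)) (hv₁ : v₁.1 = latt (Matrix.diagonal ![1, ϖ]))
    {a b : {M : Submodule 𝒪[F] (Fin 2 → F) // IsSpecialLattice (RingHom.id F) ϖ !![(0 : F), 1; -1, 0] M}}
    (hab : (latticeTree (RingHom.id F) ϖ !![(0 : F), 1; -1, 0]).Adj a b) :
    ∃ u : ↥(unitaryGroupOfForm σ !![(0 : E), 1; 1, 0]), rhoVertexAct ι σ hϖ hρ u v₀ = a ∧ rhoVertexAct ι σ hϖ hρ u v₁ = b := by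
  rcases a.2 with ha | ha
  · obtain ⟨g, hg1, hga, hgb⟩ := exists_det_eq_one_and_glVertexAct_eq_of_adj hϖ v₀ v₁ hv₀ hv₁ hab ha
    obtain ⟨u, hu⟩ := exists_mem_unitaryGroupOfForm_conj_eq_smul_map ι σ hσι hα hα0 (s := 1) (g := g)
      (by rw [hg1, map_one, map_one, one_mul, one_mul])
    exact ⟨u, by rw [rhoVertexAct_eq_glVertexAct ι σ hϖ hρ u one_ne_zero hu, hga], by rw [rhoVertexAct_eq_glVertexAct ι σ hϖ hρ u one_ne_zero hu, hgb]⟩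
  · obtain ⟨c, t, hc, ht⟩ := hnorm
    have ht0 : t ≠ 0 := by rintro rfl; rw [mul_zero, zero_mul] at ht; exact zero_ne_one ht
    obtain ⟨g, hgc, hga, hgb⟩ := exists_det_eq_and_glVertexAct_eq_of_adj hϖ v₀ v₁ hv₀ hv₁ hab ha hc
    obtain ⟨u, hu⟩ := exists_mem_unitaryGroupOfForm_conj_eq_smul_map ι σ hσι hα hα0 (s := t) (g := g) (by rw [hgc]; exact ht)
    exact ⟨u, by rw [rhoVertexAct_eq_glVertexAct ι σ hϖ hρ u ht0 hu, hga], by rw [rhoVertexAct_eq_glVertexAct ι σ hϖ hρ u ht0 hu, hgb]⟩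

end Action

end Tree

end Literature.NumberTheory.Automorphic.UnitaryGroup

end
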